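import Mathlib
import HarnessLib
import HarnessLib.Audit
import Summits.AtomisticToContinuum.Statement
import Literature.MathematicalPhysics.QuantumManyBody.PeriodicBoseGas
import Summits.AtomisticToContinuum.BoseEinsteinCondensation.Statement

/-!
Route: BECGaussianDomination

CLOSED (retired) 2026-08-15T13:38:43Z by operator:999:1257524 — reason: not-a-thesis: assembly does not conclude the sub-problem Statement — note: D-0027 §2.1 audit (human 2026-08-15: routes that do not decide the summit are removed): the assembly concludes `Literature.MathematicalPhysics.QuantumManyBody.BoseGas.BoseEinsteinCondensation`, not the sub-problem statement; a NEW conforming route may be opened from the same idea (generated `closes . The file is kept as the record of this route; refuted decls are indexed as negative knowledge (`ledger negatives`).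

X_GD (TWO-SECTOR GAUSSIAN DOMINATION; card continuum-gaussian-domination, restated in the non-sharp,
sector-coupled form the audits asked for). It suffices to show, for every repulsive finite-range
INTEGRABLE radial v (∫v < ∞):
(GaussianDomination) there are K, ρ₀, C > 0 such that for all large N, every torus of side L with
(N+1)/L³ ≤ ρ₀ and every plane wave φ_k (k = 2πn/L, 0 < |k| ≤ K), the block operator on H_N ⊕ H_{N+1}
    (H_N − E₀(N)) ⊕ (H_{N+1} − E₀(N+1)) + t·(a(φ_k) + a(φ_k)†),   a(φ_k) : H_{N+1} → H_N the
annihilation of one particle in φ_k,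
has infimum ≥ −C t² L²/|n|² for all |t| ≤ t₀(N,L,n) — equivalently (Kato, degenerate 2×2 second
order; first order vanishes by momentum conservation) the two T = 0 ONE-PARTICLE-TRANSFER
SUSCEPTIBILITIES b₊^{(N)}(k) = ⟨a†_kΩ_N,(H_{N+1}−E₀(N+1))⁻¹a†_kΩ_N⟩ and b₋^{(N+1)}(k) are ≤ C/k²
(GAUSSIAN DOMINATION UP TO A CONSTANT; Bogoliubov value b₊+b₋ = (k²+gρ)/(k²(k²+2gρ)) ≤ 1/k², g =
8πa; the sharp constant 1 is NOT claimed — it is false at one loop wherever v̂(k) < 0,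
audit-14/triage-15);
together with the two items this line does not own: the periodic→Dirichlet transfer
BoundaryTransferWeak (stmt-AtomisticToContinuum-0827, shared verbatim with route
BECPeriodicReduction) and HardCoreExtension (integrable ⇒ all finite-range v: the scope complement,
see RANKED CRUXES).
Why two sectors and not the card's number-conserving X_k = N^{-1/2}a†_ka₀: with a(φ_k) coupling
adjacent sectors, each measured from ITS OWN ground energy (no chemical potential, no convexity-in-N
hypothesis), the Kennedy–Lieb–Shastry spectral Cauchy–Schwarz gives 2n_k + 1 = ‖a_kΩ‖² + ‖a†_kΩ‖² ≤
√((b₋+b₊)(d₋+d₊)) with d₋ + d₊ = ⟨[a†_k,[H,a_k]]⟩_Ω + (μ⁻−μ⁺)n_k − μ⁺ ≤ k² + 2ρ‖v‖₁ + 2ρ‖v‖₁n_k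
VERBATIM — an occupation bound; the X_k version only bounds ⟨n̂₀n̂_k⟩/N and needs a variance/clopen
selection step (the hidden step of card thomson-flow-gaussian-domination).
Downstream is support (known technique, heavy Lean): KLSTransfer (GD ⇒ periodic infrared bound n_k ≤
C(1 + √ρ L/|n| + ρL²/|n|²) for δ-near-minimisers on the window |k| ≤ K) and ModeCounting (IR ⇒
PeriodicBEC body of stmt-0826: Parseval on the 3-torus, kinetic Chebyshev Σ_{|k|>k_c} n_k ≤ T/k_c²
with the Hartree bound T ≤ E₀+δ ≤ ½ρ‖v‖₁N + δ, window k_c = ρ^{5/12}: the IR window holds o(N) modes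
— the √(ρa³) mode deficit — so the '+1' quantum floor and a non-sharp C are affordable).
Lean: `GaussianDomination → KLSTransfer → ModeCounting → BoundaryTransferWeak → HardCoreExtension →
Literature.MathematicalPhysics.QuantumManyBody.BoseGas.BoseEinsteinCondensation`
(decls of this route over
Literature.MathematicalPhysics.QuantumManyBody.BoseGas.{IsRepulsiveFiniteRange, PeriodicTrialState,
periodicEnergy, periodicGroundStateEnergy, cellOccupation, condensateOccupation, cell, cellN,
sideLength, HasGroundStateBEC, BoseEinsteinCondensation}; rc 0 in Sketch.lean incl. the glue term
`fun hGD hT hC hB hH => hH (fun v hv hi => hB v hv (hC v hv hi (hT v hv hi (hGD v hv hi))))` and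
`ir_of_gd : GaussianDomination → KLSTransfer → PeriodicInfraredBound`).
## Assembly
GaussianDomination (crux 2) → KLSTransfer (support) → ModeCounting (support) → BoundaryTransferWeak
(crux 3, shared 0827) → HardCoreExtension (crux 4) → BoseEinsteinCondensation; PeriodicInfraredBound
(support) = GD + KLS stand-alone so that refuters can attack the IR bound itself and other engines
can target it.

Rationale: WHY THIS LINE. Reflection positivity has only ever been used to obtain ONE inequality, Gaussian
domination E₀(H(h)) ≥ E₀(H) (DLS1978; KLS1988JSP eq. (18)); everything after it — susceptibility
bound, spectral Cauchy–Schwarz with the double commutator, sum rule, mode counting in d ≥ 3 —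
"depends on no special properties of the Hamiltonian" (DLS1978 §1) and is PROVED in tree on the
lattice
(Literature.MathematicalPhysics.QuantumLattice.kls_xy_infraredBound_ground_of_gaussianDomination,
kennedy_lieb_shastry_xy_ground_of_gaussianDomination). The barrier audit of
HalfFillingReflectionPositivity records exactly this open door: a substitute for Gaussian domination
"from GD without reflection positivity of the state". This route files the continuum T = 0 GD as a
stand-alone, variational, typable conjecture in the weakest form the transfer needs (two adjacent
canonical sectors, constant C not 1, momentum window |k| ≤ K, densities ≤ ρ₀, INTEGRABLE v) and
makes the whole transfer to the conjunct formal; it is the hypothesis/target member of the GD family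
of cards (thomson-flow-gaussian-domination, log-concave-counts-brascamp-lieb,
kv-insertion-corrector, sos-infrared-certificates, diamagnetic-gd-bootstrap propose ENGINES for the
same inequality and should attach to decl GaussianDomination by signature). Imported areas:
RP/infrared-bound statistical mechanics (DLS/KLS transfer, lattice→continuum dictionary: S⁻_k ↦
a(φ_k) between sectors N+1→N; E_p ↦ k²; e₁−e₃cos p ↦ ⟨[a†,[H,a]]⟩ ≤ k²+2ρ‖v‖₁; sum rule ↦ Parseval
on the torus; d ≥ 3 integrability ↦ the o(N) mode count of the window), Kato perturbation theory
(energy-inequality ⇔ susceptibility), nothing else. Physical heuristic for GD (card): a classical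
transfer field pays Born ρv̂(0) per particle but gains only μ = 8πρa < ρv̂(0).
RANKED CRUXES. #2 GaussianDomination — the conjecture above (why it might fail: no RP; Speer1985
shows GD can fail without it; beyond one loop nothing is known to keep sup_N k²b_k bounded; source
KLS1988JSP, DLS1978, CorginiSankovich1999, LSSY2005 Ch. 11). #3 BoundaryTransferWeak — shared
stmt-0827: PeriodicBEC(v) ⇒ HasGroundStateBEC v ρ (Dirichlet, mode-free) (why it might fail: the
Dirichlet GS lies a wall term ≫ δ above E₀^per, no energy comparison; structural Neumann bracketing
unproved; Robinson1976). #4 HardCoreExtension — dilute BEC for all integrable finite-range v ⇒ for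
all finite-range v incl. hard cores (why it might fail: as a bare implication it is the conjunct on
the non-integrable class; this line's constants carry ‖v‖₁ (d_k ≤ k²+2ρ‖v‖₁, Hartree UV budget), so
truncation v∧M ↑ v is not uniform in M; needs a-only technology FournaisSolovej2022 or
Jastrow-dressed a(φ_k) — flagged as SCOPE item; the hard-core class is owned by route
BECHardSphereComparison (stmt-3438/3439), whose success moots it).
KILL CRITERIA. ¬GaussianDomination for one admissible integrable v at arbitrarily small ρ (e.g.
k²b_k → ∞ along N at fixed ρ for the smallest k) closes the route `refuted:GaussianDomination` and
retires the GD family's shared target (engines must then aim at the k⁻⁴ slack of card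
infrared-slack-audit-sinc-bound: restate with L⁴/|n|⁴). ¬PeriodicInfraredBound likewise (it is
implied). ¬BoundaryTransferWeak kills this route and BECPeriodicReduction, not the conjunct.
HardCoreExtension cannot be refuted without refuting the conjunct.
NOT DECOMPOSED YET. How to prove GaussianDomination (the engines live on other cards/routes and
attach by signature); the split of KLSTransfer into (operator realisation of the variational GD, KLS
inequality for the exact ground state, passage to C¹ near-minimisers); the split of ModeCounting
into (torus Parseval for occupations and for the kinetic energy, lattice-point sums, bookkeeping);
any dressing of a(φ_k) for hard cores; positive temperature; Dirichlet-box GD (translation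
invariance is used essentially: first order vanishes by momentum).
CHEAPEST FALSIFIER. (a) Bogoliubov/one-loop check already done by triage-15: sharp C = 1 fails iff
v̂(k) < 0 somewhere, non-sharp C = 2 survives at small ρ — consistent. (b) Next cheapest:
second-order (Beliaev/one-loop) correction to b₊+b₋ at k → 2π/L: does k²(b₊+b₋) stay bounded
uniformly in L at fixed small ρ, or pick up log(Lk) from the Gavoret–Nozières/Nepomnyashchii
infrared structure (BogoliubovPerturbationInfrared)? A divergence there would not refute GD
(perturbation theory is not a proof) but would move the bet; a one-page computation from Griffin1993
§6.3. (c) Exact check on the Tonks/Lieb–Liniger analogue is NOT a falsifier (d = 1 statement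
differs) but calibrates: there GD holds and the mode count fails, as it should.
TWO-LAYER PLAN. After GD closes (or is split by an engine route): KLSTransfer ⇐ OperatorGD →
GroundStateKLS → KLSTransfer; ModeCounting ⇐ TorusParseval → WindowSums → ModeCounting (k ≤ 3, depth
1).
NUMBERS. Bogoliubov: b₊ = u_k²/ε_k, b₋ = v_k²/ε_k, b₊+b₋ = (k²+gρ)/ε_k², 2n_k+1 = (k²+gρ)/ε_k, KLS
saturated; d_k = ⟨[a†_k,[H,a_k]]⟩ = k² + L⁻³⟨v̂(0)N̂ + Σ_q v̂(q−k)n̂_q⟩ ≤ k² + 2ρ‖v‖₁; E₀(N+1) ≥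
E₀(N) (v ≥ 0) and μ⁻ ≤ 2ρ‖v‖₁ (trial a†₀Ω_{N−1}) make d₋+d₊ ≤ k² + 2ρ‖v‖₁(1+n_k) without convexity
in N, whence the ρL²/|n|² term of the IR shape; counting with k_c = ρ^{5/12}: depletion/N ≲ ρ^{1/4}
+ ρ^{1/3} + ρ^{5/12} + ρ^{1/6}‖v‖₁ → 0. Items at open: 7 (3 cruxes, 3 support, 1 assembly).
SOURCES. DLS1978; KLS1988JSP; KLS1988PRL; LSSY2005 §1.2, Ch. 2, Ch. 5, Ch. 11; CorginiSankovich1999;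
Corgini2003; Sankovich2013; BernalCorginiSankovich2004; Speer1985; BjornbergUeltschi2022;
PitaevskiiStringari1991; Fournais2020; FournaisSolovej2020; FournaisSolovej2022; Junge2026
(arXiv:2603.20776); in tree: PeriodicBoseGas.lean (vocabulary, Fournais2020_condensation_holds),
XYOrder*.lean (lattice KLS chain, proved).
DEFINITION REQUESTS. None: the off-diagonal one-body element is written inline as a Bochner integral
with Matrix.vecCons (pattern of `occupation`); a named `transferCoupling`/two-sector susceptibility
would shorten the signatures and is suggested to the librarian, not required.
SUPPORT. KLSTransfer (GD-body ⇒ IR-body; KLS1988JSP (12)–(14) + Kato; near-minimisers by compactness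
at fixed N,L, δ after N; uses pairs (N−1,N) and (N,N+1), both covered since GD is uniform in L ≥
((N+1)/ρ₀)^{1/3}); ModeCounting (IR-body ⇒ PeriodicBEC-body of stmt-0826; Parseval, Chebyshev,
Hartree bound, lattice sums Σ_{0<|n|≤n_c}(1, 1/|n|, 1/|n|²) ≍ n_c³, n_c², n_c);
PeriodicInfraredBound (stand-alone IR = GD+KLS). All three are theorems on paper; Lean weight: 3-D
torus Fourier series, form domains, spectral theorem with compact resolvent.
DEGENERATE CASES CHECKED. v ≡ 0: b₊ = 1/k², b₋ = 0, GD true with C ≥ 1/(4π²)+; IR and counting true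
(free torus gas, gap (2π/L)²). N small / L → ∞ at fixed N (density → 0, inside '(N+1) ≤ ρ₀L³'):
ideal-gas limit, b → 1/k², fine. E₀^per < ⊤ for integrable v (constant state), so the toReal's are
honest; t₀ after (N,L,n) and K existential are the weakest forms and are all the transfer uses
(checked in Sketch: ir_of_gd, assembly_glue).

Novelty: Searches run (2026-08-15, this seat): `lit frontier AtomisticToContinuum --since 2020` (BEC
descendants: arXiv:2603.20776 Junge2026, arXiv:2510.20493, arXiv:2602.16566 — all gap/localisation
energy methods, no IR bounds); `lit bridges AtomisticToContinuum --cross any` (only Rougerie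
arXiv:2002.02678 touches KLS1988PRL, as a citation); `lit search --source crossref "Gaussian
domination Bose Einstein condensation interacting boson gas"` → doi:10.1142/s0217979299002988
CorginiSankovich1999, doi:10.1007/978-3-0348-8018-3_5 Corgini2003,
doi:10.1016/j.physleta.2013.08.045 Sankovich2013 (+ BernalCorginiSankovich2004
doi:10.1023/b:tamp.0000029708.30746.56 from the card audit); `lit search --source crossref "infrared
bounds ground state ... Kennedy Lieb Shastry"` → FSS1976 doi:10.1007/bf01608557,
BjornbergUeltschi2022 doi:10.4171/90-1/5 (2022 review: RP/IR bounds still lattice-and-symmetry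
bound); `lit galaxy search "Gaussian domination" --star all` (18 rows: Friedli–Velenik, LSSY2005,
Fröhlich school, Tasaki thesis — classical/lattice only); `lit read doi:10.1142/s0217979299002988`
paywalled (acq-01315 cite-only); openalex/arXiv 429 this hour; plus the two refuter audits on the
card (audit-2, audit-14) and triage-15 on infrared-slack-audit-sinc-bound. Nearest prior art FOUND:
CorginiSankovich1999 / Corgini2003 / Sankovich2013 / BernalCorginiSankovich2004 (postulate a GD-type
bound on Bogoliubov–Duhamel inner products ⇒ BEC, for superstable/diagonal or lattice boson models,
T > 0, gra  [refs: 10.1142/s0217979299002988, 10.1007/978-3-0348-8018-3_5, 10.1016/j.physleta.2013.08.045, 10.1023/b:tamp.0000029708.30746.56, 10.1007/bf01608557, 10.4171/90-1/5, 10.1142/s0217979299002988`, 2603.20776, 2510.20493, 2602.16566, 2002.02678, doi:10.1142/s0217979299002988, doi:10.1007/978-3-0348-8018-3_5, doi:10.1016/j.physleta.2013.08.045, doi:10.1023/b, doi:10.1007/bf01608557, doi:10.4171/90-1/5, Junge]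

Barriers (technique_class: Gaussian-domination infrared-bound KLS-transfer variational): - technique_class: Gaussian-domination infrared-bound KLS-transfer variational
- Literature.Barriers.AtomisticToContinuum.HalfFillingReflectionPositivity: attacked head-on and by
the door its own audit names ("a substitute for (Aᵀ) … from Gaussian domination without reflection
positivity of the state"): RP is used in print ONLY to get GD; here GD is the crux itself, stated
variationally on the continuum torus with no lattice, no half filling, no particle–hole symmetry;
everything downstream of GD is symmetry-free (DLS1978 §1) and proved in tree on the lattice. Honest:
no proof technique for GD without RP is in hand on this route (engines are other cards); the bet is
Born > scattering length plus the constant/exponent slack of the dilute window.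
- Literature.Barriers.AtomisticToContinuum.HalfFillingReflectionPositivityNarrow: consistent — its
rigidity lemmas concern site-local antiunitary reflections of a lattice STATE; no reflection of any
kind is posited here.
- Literature.Barriers.AtomisticToContinuum.KineticGapLengthScales: evaded — no spectral gap at scale
L is ever multiplied by L²; the IR bound is gap-free and the UV tail uses only kinetic Chebyshev
with the Hartree energy budget; L-uniformity is carried entirely by the conjectured constant C of
GD.
- Literature.Barriers.AtomisticToContinuum.EnergyAsymptoticsWithoutCondensation: evaded by design —
GD is an energy inequality for a FAMILY of perturbed two-sector Hamiltonians (a response/curvature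
statement, the entry's li

History (route lifecycle, newest last):
- 2026-08-15T13:38:43Z · CLOSED retired — not-a-thesis: assembly does not conclude the sub-problem Statement (operator:999:1257524)

sub-problem: BoseEinsteinCondensation · status: closed(retired) · opened planner-plancard-AtomisticToContinuum-BoseEin-5cc91b26-0 2026-08-15T11:21:07Z · rev 0 · ledger route-AtomisticToContinuum-BECGaussianDomination
GENERATED by the gate from the ledger (D-0016/17). Provers cite these decls: `theorem foo : Summit.AtomisticToContinuum.BoseEinsteinCondensation.Theses.BECGaussianDomination.<Decl> := …` in Summits/AtomisticToContinuum/BoseEinsteinCondensation/Theorems/<Name>.lean.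
-/

namespace Summit.AtomisticToContinuum.BoseEinsteinCondensation.Theses.BECGaussianDomination

open scoped BigOperators Topology Manifold Classical MeasureTheory ProbabilityTheory Matrix InnerProductSpace ComplexConjugate ContinuousMap
open Filter Set Function TopologicalSpace MeasureTheory

attribute [summit_statement] _root_.BoseEinsteinCondensation

/-- item stmt-AtomisticToContinuum-3627 · crux · rank 2 · closed · moot by None · by planner
why it might fail: No reflection positivity: beyond one loop nothing known keeps sup_N k²·b_k bounded at fixed small ρ (anomalous infrared propagators could add log(Lk)); Speer1985: GD can fail without RP; uniformity in L ≥ ((N+1)/ρ₀)^{1/3} is also asserted.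
sources: KLS1988JSP, DLS1978, CorginiSankovich1999, LSSY2005 Ch. 11 §11.1, Speer1985, BjornbergUeltschi2022
[crux] TWO-SECTOR GAUSSIAN DOMINATION (non-sharp, windowed, integrable v; card
continuum-gaussian-domination restated per audit-14/triage-15). For every repulsive finite-range
integrable radial v there are K, ρ₀, C > 0 such that for all large N, every L > 0 with (N+1)/L³ ≤
ρ₀, every n ∈ ℤ³∖{0} with |2πn/L| ≤ K, some t₀ = t₀(N,L,n) > 0, all |t| ≤ t₀, all p ∈ [0,1] and all
finite-energy periodic trial states Ψ (N particles), Φ (N+1 particles) on the torus of side L: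
p(E(Ψ) − E₀(N)) + (1−p)(E(Φ) − E₀(N+1)) + 2t√(p(1−p))·Re⟨Ψ, a(φ_n)Φ⟩ ≥ −C t² L²/‖n‖², where ⟨Ψ,
a(φ_n)Φ⟩ = √(N+1)∫conj(Ψ(Y))∫conj(φ_n(x))Φ(x,Y)dx dY and φ_n = L^{-3/2}e^{2πi n·x/L}. This is the
variational form of inf spec[(H_N−E₀(N)) ⊕ (H_{N+1}−E₀(N+1)) + t(a(φ_n)+a(φ_n)†)] ≥ −Ct²L²/‖n‖²,
equivalent (Kato; first order vanishes by momentum conservation) to the bound b₊^{(N)}(k),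
b₋^{(N+1)}(k) ≤ C L²/‖n‖² ≍ C′/k² on the two T=0 one-particle-transfer susceptibilities — Gaussian
domination up to a constant (DLS1978 / KLS1988JSP eq. (18) obtain the lattice analogue from
reflection positivity; none is available here). Bogoliubov: b₊+b₋ = (k²+8πρa)/(k²(k²+16πρa)) ≤ 1/k².
The shared TARGET of the GD-engine cards (thomson-flow-ga -/
@[route_item "route-AtomisticToContinuum-BECGaussianDomination"]
def GaussianDomination : Prop :=
  ∀ v : ℝ → ENNReal, Literature.MathematicalPhysics.QuantumManyBody.BoseGas.IsRepulsiveFiniteRange v → (∫⁻ x : EuclideanSpace ℝ (Fin 3), v ‖x‖) ≠ ⊤ → ∃ K : ℝ, 0 < K ∧ ∃ ρ₀ : ℝ, 0 < ρ₀ ∧ ∃ C : ℝ, 0 < C ∧ ∀ᶠ N : ℕ in Filter.atTop, ∀ L : ℝ, 0 < L → ((N : ℝ) + 1) ≤ ρ₀ * L ^ 3 → ∀ n : Fin 3 → ℤ, n ≠ 0 → 2 * Real.pi / L * ‖(fun j => (n j : ℝ))‖ ≤ K → ∃ t₀ : ℝ, 0 < t₀ ∧ ∀ t : ℝ, |t|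 ≤ t₀ → ∀ p : ℝ, 0 ≤ p → p ≤ 1 → ∀ Ψ : Literature.MathematicalPhysics.QuantumManyBody.BoseGas.PeriodicTrialState N L, ∀ Φ : Literature.MathematicalPhysics.QuantumManyBody.BoseGas.PeriodicTrialState (N + 1) L, Literature.MathematicalPhysics.QuantumManyBody.BoseGas.periodicEnergy v Ψ ≠ ⊤ → Literature.MathematicalPhysics.QuantumManyBody.BoseGas.periodicEnergy v Φ ≠ ⊤ → p * (Literature.MathematicalPhysics.QuantumManyBody.BoseGas.periodicGroundStateEnergy v N L).toReal + (1 - p) * (Literature.MathematicalPhysics.QuantumManyBody.BoseGas.periodicGroundStateEnergy v (N + 1) L).toReal - C * t ^ 2 * L ^ 2 / ‖(fun j => (n j : ℝ))‖ ^ 2 ≤ p * (Literature.MathematicalPhysics.QuantumManyBody.BoseGas.periodicEnergy v Ψ).toReal + (1 - p) * (Literature.MathematicalPhysics.QuantumManyBody.BoseGas.periodicEnergy v Φ).toReal + 2 * t * Real.sqrt (p * (1 - p)) * Real.sqrt ((N : ℝ) + 1) * (∫ Y in Literature.MathematicalPhysics.QuantumManyBody.BoseGas.cellN N L, (starRingEnd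 ℂ) (Ψ.ψ Y) * ∫ x in Literature.MathematicalPhysics.QuantumManyBody.BoseGas.cell L, (starRingEnd ℂ) ((((Real.sqrt (L ^ 3))⁻¹ : ℝ) : ℂ) * Complex.exp (Complex.I * ↑(2 * Real.pi / L * ∑ j, (n j : ℝ) * x j))) * Φ.ψ (Matrix.vecCons x Y)).re

/-- item stmt-AtomisticToContinuum-0827 · crux · rank 3 · open · by planner
why it might fail: PeriodicBEC(v) is ground-state-only (δ after N) at the box (N/ρ)^{1/3}: the Dirichlet GS is a periodic trial state but lies a wall term ≫δ above E₀^per, so the hypothesis may never fire without a structural (Neumann-bracketing) argument; BEC is BC-sensitive (Robinson1976).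
sources: LSSY2005 Ch. 2 after (2.2) and (2.8), doi:10.1007/bf01608554, arXiv:2603.20776, arXiv:2205.15284
[crux] BoundaryTransferWeak (mode-free boundary-condition transfer, per potential): for each
repulsive finite-range v, PeriodicBEC(v) implies ∃ρ₀>0 ∀ρ∈(0,ρ₀) HasGroundStateBEC v ρ (Dirichlet
ground state, λ_max(γ) ≥ cN via condensateNumber). Not glue: near-minimiser slacks are O(N/L²) while
Dirichlet/periodic energies differ by a boundary term ≫ N/L², so no energy-comparison proof;
expected route: Neumann bracketing of interior sub-boxes (−Δ_Dir ≥ ⊕−Δ_Neu, v ≥ 0) + a mode-free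
criterion (λ_max ≥ tr γ²/N). Only the ENERGY analogue is in print (LiebSeiringerSolovejYngvason2005
Ch. 2 after (2.8)). v ≡ 0: hypothesis and conclusion both true. -/
@[route_item "route-AtomisticToContinuum-BECGaussianDomination"]
def BoundaryTransferWeak : Prop :=
  ∀ v : ℝ → ENNReal, Literature.MathematicalPhysics.QuantumManyBody.BoseGas.IsRepulsiveFiniteRange v → (∃ ρ₀ : ℝ, 0 < ρ₀ ∧ ∀ ρ : ℝ, 0 < ρ → ρ < ρ₀ → ∃ c : ℝ, 0 < c ∧ ∀ᶠ N : ℕ in Filter.atTop, ∃ δ : ENNReal, 0 < δ ∧ ∀ Ψ : Literature.MathematicalPhysics.QuantumManyBody.BoseGas.PeriodicTrialState N (Literature.MathematicalPhysics.QuantumManyBody.BoseGas.sideLength ρ N), Literature.MathematicalPhysics.QuantumManyBody.BoseGas.periodicEnergy v Ψ ≤ Literature.MathematicalPhysics.QuantumManyBody.BoseGas.periodicGroundStateEnergy v N (Literature.MathematicalPhysics.QuantumManyBody.BoseGas.sideLength ρ N) + δ → ENNReal.ofReal (c * N) ≤ Literature.MathematicalPhysics.QuantumManyBody.BoseGas.condensateOccupation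 N (Literature.MathematicalPhysics.QuantumManyBody.BoseGas.sideLength ρ N) Ψ.ψ) → ∃ ρ₀ : ℝ, 0 < ρ₀ ∧ ∀ ρ : ℝ, 0 < ρ → ρ < ρ₀ → Literature.MathematicalPhysics.QuantumManyBody.BoseGas.HasGroundStateBEC v ρ

/-- item stmt-AtomisticToContinuum-3628 · crux · rank 4 · closed · moot by None · by planner
why it might fail: As a bare implication it is the conjunct restricted to non-integrable (hard-core) potentials; no comparison or truncation principle transferring condensate bounds from v∧M to v uniformly in M is known, and condensate fractions are not monotone in v.
sources: FournaisSolovej2022, LSSY2005 Lemma 2.5 and Ch. 5, Fournais2020 Assumption 1.1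
[crux] SCOPE ITEM (the part of the conjunct this line does not reach): dilute ground-state BEC for
every repulsive finite-range INTEGRABLE radial v (∫v(|x|)dx < ∞) implies it for every repulsive
finite-range radial v, i.e. also for hard cores v = ⊤·1_{[0,a]} (+ tail). Expected proof shape:
truncations v∧M ↑ v are admissible and integrable; at fixed N, L monotone form convergence gives
E₀(v∧M) ↑ E₀(v) and λ_max(γ) of near-minimisers converges, so UNIFORM-in-M constants (ρ₀, c, N₀) for
v∧M would suffice — but this line's constants carry ‖v‖₁ (double commutator k²+2ρ‖v‖₁, Hartree UV
budget ½ρ‖v‖₁N), so it cannot supply uniformity; a-only technology (FournaisSolovej2022 hard-core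
LHY; LSSY2005 Lemma 2.5 Dyson lemma) or a Jastrow-dressed transfer operator a(fφ_k) is needed. Filed
so the gap is visible and ownable: the hard-core class is attacked head-on by route
BECHardSphereComparison (HardSphereBEC = stmt-AtomisticToContinuum-3439 is the conjunct at v = HS_a;
with its HardCoreDominates stmt-3438 that route proves the whole conjunct and moots this item), and
by the dressing cards jastrow-parent-kac-splitting / wall-dressing-transfer. [difficulty:
open-problem] -/
@[route_item "route-AtomisticToContinuum-BECGaussianDomination"]
def HardCoreExtension : Prop :=
  (∀ v : ℝ → ENNReal, Literature.MathematicalPhysics.QuantumManyBody.BoseGas.IsRepulsiveFiniteRange v → (∫⁻ x : EuclideanSpace ℝ (Fin 3), v ‖x‖) ≠ ⊤ → ∃ ρ₀ : ℝ, 0 < ρ₀ ∧ ∀ ρ : ℝ, 0 < ρ → ρ < ρ₀ → Literature.MathematicalPhysics.QuantumManyBody.BoseGas.HasGroundStateBEC v ρ) → Literature.MathematicalPhysics.QuantumManyBody.BoseGas.BoseEinsteinCondensation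

/-- item stmt-AtomisticToContinuum-3629 · support · rank 9 · closed · moot by None · by planner
[support] KENNEDY–LIEB–SHASTRY T=0 TRANSFER in the continuum: for integrable v, the
GaussianDomination body implies the periodic infrared bound body — ∃K,ρ₀,C: ∀ρ<ρ₀ ∀ᶠN ∃δ>0, every
δ-near-minimiser Ψ of the periodic N-body energy on the torus of side L=(N/ρ)^{1/3} has plane-wave
occupations n_Ψ(2πn/L) ≤ C(1 + √ρ·L/‖n‖ + ρL²/‖n‖²) for 0<‖2πn/L‖≤K. Proof on paper (KLS1988JSP
(12)–(14), DLS1978 §1 "no special properties of H"): (i) variational GD ⇒ operator inequality for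
the form realisation ⇒ (Kato, 2×2 degenerate second order, first order = 0 by momentum) b₊^{(N)},
b₋^{(N)} ≤ CL²/‖n‖² using the pairs (N,N+1) and (N−1,N) at the same L (both inside "(N+1) ≤ ρ₀L³");
(ii) for the exact ground state Ω: 2n_k+1 = ‖a_kΩ‖²+‖a†_kΩ‖² ≤ √((b₋+b₊)(d₋+d₊)) (Cauchy–Schwarz in
the spectral measures of H_{N∓1}−E₀(N∓1) ≥ 0), with d₋+d₊ = ⟨[a†_k,[H,a_k]]⟩_Ω + (μ⁻−μ⁺)n_k − μ⁺ ≤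
k² + 2ρ‖v‖₁(1+n_k) (|v̂| ≤ ‖v‖₁; E₀(N+1) ≥ E₀(N) for v ≥ 0; μ⁻ ≤ Cρ‖v‖₁ by the trial state
a†₀Ω_{N−1}); solve the quadratic inequality; (iii) pass to C¹ δ-near-minimisers by compactness at
fixed N, L (δ after N; finitely many n in the window). Lean weight: form domains, spectral theorem
with compact resolvent, Bochner/Fubini o -/
@[route_item "route-AtomisticToContinuum-BECGaussianDomination"]
def KLSTransfer : Prop :=
  ∀ v : ℝ → ENNReal, Literature.MathematicalPhysics.QuantumManyBody.BoseGas.IsRepulsiveFiniteRange v → (∫⁻ x : EuclideanSpace ℝ (Fin 3), v ‖x‖) ≠ ⊤ → (∃ K : ℝ, 0 < K ∧ ∃ ρ₀ : ℝ, 0 < ρ₀ ∧ ∃ C : ℝ, 0 < C ∧ ∀ᶠ N : ℕ in Filter.atTop, ∀ L : ℝ, 0 < L → ((N : ℝ) + 1) ≤ ρ₀ * L ^ 3 → ∀ n : Fin 3 → ℤ, n ≠ 0 → 2 * Real.pi / L * ‖(fun j => (n j : ℝ))‖ ≤ K → ∃ t₀ : ℝ, 0 < t₀ ∧ ∀ t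 : ℝ, |t| ≤ t₀ → ∀ p : ℝ, 0 ≤ p → p ≤ 1 → ∀ Ψ : Literature.MathematicalPhysics.QuantumManyBody.BoseGas.PeriodicTrialState N L, ∀ Φ : Literature.MathematicalPhysics.QuantumManyBody.BoseGas.PeriodicTrialState (N + 1) L, Literature.MathematicalPhysics.QuantumManyBody.BoseGas.periodicEnergy v Ψ ≠ ⊤ → Literature.MathematicalPhysics.QuantumManyBody.BoseGas.periodicEnergy v Φ ≠ ⊤ → p * (Literature.MathematicalPhysics.QuantumManyBody.BoseGas.periodicGroundStateEnergy v N L).toReal + (1 - p) * (Literature.MathematicalPhysics.QuantumManyBody.BoseGas.periodicGroundStateEnergy v (N + 1) L).toReal - C * t ^ 2 * L ^ 2 / ‖(fun j => (n j : ℝ))‖ ^ 2 ≤ p * (Literature.MathematicalPhysics.QuantumManyBody.BoseGas.periodicEnergy v Ψ).toReal + (1 - p) * (Literature.MathematicalPhysics.QuantumManyBody.BoseGas.periodicEnergy v Φ).toReal + 2 * t * Real.sqrt (p * (1 - p)) * Real.sqrt ((N : ℝ) + 1) * (∫ Y in Literature.MathematicalPhysics.QuantumManyBody.BoseGas.cellN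 N L, (starRingEnd ℂ) (Ψ.ψ Y) * ∫ x in Literature.MathematicalPhysics.QuantumManyBody.BoseGas.cell L, (starRingEnd ℂ) ((((Real.sqrt (L ^ 3))⁻¹ : ℝ) : ℂ) * Complex.exp (Complex.I * ↑(2 * Real.pi / L * ∑ j, (n j : ℝ) * x j))) * Φ.ψ (Matrix.vecCons x Y)).re) → ∃ K : ℝ, 0 < K ∧ ∃ ρ₀ : ℝ, 0 < ρ₀ ∧ ∃ C : ℝ, 0 < C ∧ ∀ ρ : ℝ, 0 < ρ → ρ < ρ₀ → ∀ᶠ N : ℕ in Filter.atTop, ∃ δ : ENNReal, 0 < δ ∧ ∀ Ψ : Literature.MathematicalPhysics.QuantumManyBody.BoseGas.PeriodicTrialState N (Literature.MathematicalPhysics.QuantumManyBody.BoseGas.sideLength ρ N), Literature.MathematicalPhysics.QuantumManyBody.BoseGas.periodicEnergy v Ψ ≤ Literature.MathematicalPhysics.QuantumManyBody.BoseGas.periodicGroundStateEnergy v N (Literature.MathematicalPhysics.QuantumManyBody.BoseGas.sideLength ρ N) + δ → ∀ n : Fin 3 → ℤ, n ≠ 0 → 2 * Real.pi / Literature.MathematicalPhysics.QuantumManyBody.BoseGas.sideLength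 ρ N * ‖(fun j => (n j : ℝ))‖ ≤ K → Literature.MathematicalPhysics.QuantumManyBody.BoseGas.cellOccupation N (Literature.MathematicalPhysics.QuantumManyBody.BoseGas.sideLength ρ N) (fun x : EuclideanSpace ℝ (Fin 3) => (((Real.sqrt ((Literature.MathematicalPhysics.QuantumManyBody.BoseGas.sideLength ρ N) ^ 3))⁻¹ : ℝ) : ℂ) * Complex.exp (Complex.I * ↑(2 * Real.pi / (Literature.MathematicalPhysics.QuantumManyBody.BoseGas.sideLength ρ N) * ∑ j, (n j : ℝ) * x j))) Ψ.ψ ≤ ENNReal.ofReal (C * (1 + Real.sqrt ρ * Literature.MathematicalPhysics.QuantumManyBody.BoseGas.sideLength ρ N / ‖(fun j => (n j : ℝ))‖ + ρ * Literature.MathematicalPhysics.QuantumManyBody.BoseGas.sideLength ρ N ^ 2 / ‖(fun j => (n j : ℝ))‖ ^ 2))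

/-- item stmt-AtomisticToContinuum-3630 · support · rank 9 · closed · moot by None · by planner
[support] MODE COUNTING WITH THE √(ρa³) MODE DEFICIT: for integrable v, the periodic infrared bound
body implies the PeriodicBEC body of stmt-AtomisticToContinuum-0826 verbatim (constant-mode
occupation ≥ cN, c = 1/2). Proof on paper: Parseval on the 3-torus for x ↦ Ψ(x,Y) gives Σ_{n∈ℤ³}
n_Ψ(2πn/L) = N and Σ_n |2πn/L|² n_Ψ = kinetic energy T(Ψ) ≤ E₀^per + δ ≤ ½ρ‖v‖₁N + δ (constant trial
state: E₀^per ≤ N(N−1)‖v‖₁/(2L³)); choose k_c = ρ^{5/12} (inside the window for ρ small, n_c =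
k_cL/2π ≥ 1 for N large): Σ_{0<|k|≤k_c} C(1+√ρL/|n|+ρL²/|n|²) ≲ C(k_c³/ρ + k_c²/√ρ + k_c)N and
Σ_{|k|>k_c} n_k ≤ (½ρ‖v‖₁N+δ)/k_c², all o(N) as ρ → 0; pick ρ₀ so the total is ≤ N/2. Lattice-sum
lemmas Σ_{0<‖n‖≤m}(1, 1/‖n‖, 1/‖n‖²) ≤ C(m³, m², m) are shared in spirit with stmt-0690/0735. Lean
weight: 3-D Fourier series on the torus (Mathlib: AddCircle is 1-D), tsum/lintegral interchange.
[deps: KLSTransfer] [difficulty: L] -/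
@[route_item "route-AtomisticToContinuum-BECGaussianDomination"]
def ModeCounting : Prop :=
  ∀ v : ℝ → ENNReal, Literature.MathematicalPhysics.QuantumManyBody.BoseGas.IsRepulsiveFiniteRange v → (∫⁻ x : EuclideanSpace ℝ (Fin 3), v ‖x‖) ≠ ⊤ → (∃ K : ℝ, 0 < K ∧ ∃ ρ₀ : ℝ, 0 < ρ₀ ∧ ∃ C : ℝ, 0 < C ∧ ∀ ρ : ℝ, 0 < ρ → ρ < ρ₀ → ∀ᶠ N : ℕ in Filter.atTop, ∃ δ : ENNReal, 0 < δ ∧ ∀ Ψ : Literature.MathematicalPhysics.QuantumManyBody.BoseGas.PeriodicTrialState N (Literature.MathematicalPhysics.QuantumManyBody.BoseGas.sideLength ρ N), Literature.MathematicalPhysics.QuantumManyBody.BoseGas.periodicEnergy v Ψ ≤ Literature.MathematicalPhysics.QuantumManyBody.BoseGas.periodicGroundStateEnergy v N (Literature.MathematicalPhysics.QuantumManyBody.BoseGas.sideLength ρ N) + δ → ∀ n : Fin 3 → ℤ, n ≠ 0 → 2 * Real.pi / Literature.MathematicalPhysics.QuantumManyBody.BoseGas.sideLength ρ N * ‖(fun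 j => (n j : ℝ))‖ ≤ K → Literature.MathematicalPhysics.QuantumManyBody.BoseGas.cellOccupation N (Literature.MathematicalPhysics.QuantumManyBody.BoseGas.sideLength ρ N) (fun x : EuclideanSpace ℝ (Fin 3) => (((Real.sqrt ((Literature.MathematicalPhysics.QuantumManyBody.BoseGas.sideLength ρ N) ^ 3))⁻¹ : ℝ) : ℂ) * Complex.exp (Complex.I * ↑(2 * Real.pi / (Literature.MathematicalPhysics.QuantumManyBody.BoseGas.sideLength ρ N) * ∑ j, (n j : ℝ) * x j))) Ψ.ψ ≤ ENNReal.ofReal (C * (1 + Real.sqrt ρ * Literature.MathematicalPhysics.QuantumManyBody.BoseGas.sideLength ρ N / ‖(fun j => (n j : ℝ))‖ + ρ * Literature.MathematicalPhysics.QuantumManyBody.BoseGas.sideLength ρ N ^ 2 / ‖(fun j => (n j : ℝ))‖ ^ 2))) → ∃ ρ₀ : ℝ, 0 < ρ₀ ∧ ∀ ρ : ℝ, 0 < ρ → ρ < ρ₀ → ∃ c : ℝ, 0 < c ∧ ∀ᶠ N : ℕ in Filter.atTop, ∃ δ : ENNReal, 0 < δ ∧ ∀ Ψ : Literature.MathematicalPhysics.QuantumManyBody.BoseGas.PeriodicTrialState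 N (Literature.MathematicalPhysics.QuantumManyBody.BoseGas.sideLength ρ N), Literature.MathematicalPhysics.QuantumManyBody.BoseGas.periodicEnergy v Ψ ≤ Literature.MathematicalPhysics.QuantumManyBody.BoseGas.periodicGroundStateEnergy v N (Literature.MathematicalPhysics.QuantumManyBody.BoseGas.sideLength ρ N) + δ → ENNReal.ofReal (c * N) ≤ Literature.MathematicalPhysics.QuantumManyBody.BoseGas.condensateOccupation N (Literature.MathematicalPhysics.QuantumManyBody.BoseGas.sideLength ρ N) Ψ.ψ

/-- item stmt-AtomisticToContinuum-3631 · support · rank 9 · closed · moot by None · by planner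
[support] STAND-ALONE PERIODIC T=0 INFRARED BOUND (= GaussianDomination + KLSTransfer, theorem
ir_of_gd of the sketch; the torus twin of BECInfraredBound.BecIrBoundInner with the cruder KLS
shape): for every repulsive finite-range integrable v there are K, ρ₀, C such that for ρ < ρ₀, all
large N, some δ > 0 and every δ-near-minimiser Ψ of the periodic energy (L = (N/ρ)^{1/3}),
n_Ψ(2πn/L) ≤ C(1 + √ρL/‖n‖ + ρL²/‖n‖²) for 0 < ‖2πn/L‖ ≤ K. Filed separately so that refuters can
attack the infrared bound itself (its refutation kills the route) and so that non-GD engines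
(sector-gap / Landau cards) can target it by signature. Bogoliubov truth: n_k ≈ √(πρa)/|k| ∧
(ρa)²/|k|⁴. [deps: GaussianDomination, KLSTransfer] [difficulty: open-problem stand-alone;
provable-now given deps] -/
@[route_item "route-AtomisticToContinuum-BECGaussianDomination"]
def PeriodicInfraredBound : Prop :=
  ∀ v : ℝ → ENNReal, Literature.MathematicalPhysics.QuantumManyBody.BoseGas.IsRepulsiveFiniteRange v → (∫⁻ x : EuclideanSpace ℝ (Fin 3), v ‖x‖) ≠ ⊤ → ∃ K : ℝ, 0 < K ∧ ∃ ρ₀ : ℝ, 0 < ρ₀ ∧ ∃ C : ℝ, 0 < C ∧ ∀ ρ : ℝ, 0 < ρ → ρ < ρ₀ → ∀ᶠ N : ℕ in Filter.atTop, ∃ δ : ENNReal, 0 < δ ∧ ∀ Ψ : Literature.MathematicalPhysics.QuantumManyBody.BoseGas.PeriodicTrialState N (Literature.MathematicalPhysics.QuantumManyBody.BoseGas.sideLength ρ N), Literature.MathematicalPhysics.QuantumManyBody.BoseGas.periodicEnergy v Ψ ≤ Literature.MathematicalPhysics.QuantumManyBody.BoseGas.periodicGroundStateEnergy v N (Literature.MathematicalPhysics.QuantumManyBody.BoseGas.sideLength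 ρ N) + δ → ∀ n : Fin 3 → ℤ, n ≠ 0 → 2 * Real.pi / Literature.MathematicalPhysics.QuantumManyBody.BoseGas.sideLength ρ N * ‖(fun j => (n j : ℝ))‖ ≤ K → Literature.MathematicalPhysics.QuantumManyBody.BoseGas.cellOccupation N (Literature.MathematicalPhysics.QuantumManyBody.BoseGas.sideLength ρ N) (fun x : EuclideanSpace ℝ (Fin 3) => (((Real.sqrt ((Literature.MathematicalPhysics.QuantumManyBody.BoseGas.sideLength ρ N) ^ 3))⁻¹ : ℝ) : ℂ) * Complex.exp (Complex.I * ↑(2 * Real.pi / (Literature.MathematicalPhysics.QuantumManyBody.BoseGas.sideLength ρ N) * ∑ j, (n j : ℝ) * x j))) Ψ.ψ ≤ ENNReal.ofReal (C * (1 + Real.sqrt ρ * Literature.MathematicalPhysics.QuantumManyBody.BoseGas.sideLength ρ N / ‖(fun j => (n j : ℝ))‖ + ρ * Literature.MathematicalPhysics.QuantumManyBody.BoseGas.sideLength ρ N ^ 2 / ‖(fun j => (n j : ℝ))‖ ^ 2))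

/-- item stmt-AtomisticToContinuum-3632 · assembly · rank 1 · closed · moot by None · by planner
sources: KLS1988JSP, LSSY2005 Ch. 5
[assembly] GaussianDomination → KLSTransfer → ModeCounting → BoundaryTransferWeak →
HardCoreExtension → BoseEinsteinCondensation (decls of this route; term proof checked in
Sketch.lean: fun hGD hT hC hB hH => hH (fun v hv hi => hB v hv (hC v hv hi (hT v hv hi (hGD v hv
hi))))). -/
@[route_item "route-AtomisticToContinuum-BECGaussianDomination"]
def Assembly : Prop :=
  GaussianDomination → KLSTransfer → ModeCounting → BoundaryTransferWeak → HardCoreExtension → Literature.MathematicalPhysics.QuantumManyBody.BoseGas.BoseEinsteinCondensation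

end Summit.AtomisticToContinuum.BoseEinsteinCondensation.Theses.BECGaussianDomination
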